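import Literature.Topology.PlanarFoliations.VProcess
import HarnessLib

/-!
# The components of the region of image-null closed leaves

Topic: Topology / PlanarFoliations, sequel to `VProcess.lean`. The connected components of the
open set `V` of points with image-null compact leaf are open (the domain is locally connected),
preconnected, saturated (leaves are connected subsets of `V`) and maximal; so
`exists_vanishingCycle_of_mem_frontier` applies to them: **a component of `V` whose closure maps
into a compact part of the region and whose frontier contains a point with compact leaf yields a
vanishing cycle** (Camacho–Lins Neto, Ch. VII §2 Prop. 1, the regions `Vᵢ`).

* `PunctureData.isSaturated_connectedComponentIn`, `PunctureData.exists_vanishingCycle_of_component`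
  (**proved**).

All statements are [folklore].
-/

noncomputable section

open Set Filter Function Bornology Metric
open _root_.Topology unitInterval
open Literature.Topology.FourManifolds Literature.Topology.FourManifolds.Foliation
  Literature.Topology.FourManifolds.OneManifold Literature.Topology.PlaneTopology

namespace Literature.Topology.PlanarFoliations

variable {X : Type*} [TopologicalSpace X] [T2Space X] [SecondCountableTopology X] {F : Foliation ℝ X}
variable {ι : X → ℂ}
variable {B : Type*} [NormedAddCommGroup B] [NormedSpace ℝ B] [LocallyConnectedSpace B] {M : Type*} [TopologicalSpace M]
  {T : Foliation B M} {g : ℂ → M}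

omit [T2Space X] [SecondCountableTopology X] in
/-- Leaves are preconnected subsets. [folklore] -/
theorem isPreconnected_leaf (y : X) : IsPreconnected (F.leaf y) := by
  have h : F.leaf y = range fun q : F.Leaf y ↦ ofLeafSpace (q : F.LeafSpace) := by
    ext z
    exact ⟨fun hz ↦ ⟨Leaf.mk z hz, rfl⟩, by rintro ⟨q, rfl⟩; exact q.2⟩
  rw [h]
  exact (isConnected_range (Leaf.continuous_coe F y)).isPreconnected

namespace PunctureData

variable (D : PunctureData F ι T g)

omit [T2Space X] [SecondCountableTopology X] [NormedSpace ℝ B] [LocallyConnectedSpace B] in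
/-- **The components of a saturated set with connected leaves are saturated**: here for the set
`V` of image-null points. [folklore] -/
theorem isSaturated_connectedComponentIn (w : X) :
    F.IsSaturated (connectedComponentIn {z | ImageNull D.foliated z} w) := by
  set V : Set X := {z | ImageNull D.foliated z} with hV
  intro z hz
  have hzV : ImageNull D.foliated z := (connectedComponentIn_subset V w hz : z ∈ V)
  have hleafV : F.leaf z ⊆ V := fun z' hz' ↦ show ImageNull D.foliated z' from hzV.of_mem_leaf hz'
  have hsub : F.leaf z ⊆ connectedComponentIn V z :=
    (isPreconnected_leaf z).subset_connectedComponentIn (F.mem_leaf_self z) hleafV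
  rwa [← connectedComponentIn_eq hz] at hsub

/-- **A component of the region of image-null closed leaves with a compact frontier leaf yields
a vanishing cycle.** [cite: CamachoLinsNeto1985, Ch. VII §2 Prop. 1] -/
theorem exists_vanishingCycle_of_component (hbi : IsBiOriented F) (hι : IsOpenEmbedding ι) (ho : F.IsTransverselyOriented)
    {w : X} {C : Set ℂ} (hC : IsCompact C) (hCΩ : C ⊆ D.Ω)
    (hWC : ∀ z ∈ closure (connectedComponentIn {z | ImageNull D.foliated z} w), ι z ∈ C) {y : X}
    (hy : y ∈ frontier (connectedComponentIn {z | ImageNull D.foliated z} w)) (hK : IsCompact (F.leaf y)) :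
    ∃ Cv : T.VanishingCycle, ∀ θ, Cv.fam 0 θ ∈ (g ∘ ι) '' F.leaf y := by
  haveI : LocallyConnectedSpace X := hι.locallyConnectedSpace
  set V : Set X := {z | ImageNull D.foliated z} with hV
  have hVo : IsOpen V := isOpen_setOf_imageNull hbi D.foliated ho
  set W := connectedComponentIn V w with hW
  refine D.exists_vanishingCycle_of_mem_frontier hbi hι ho hVo.connectedComponentIn (D.isSaturated_connectedComponentIn w)
    isPreconnected_connectedComponentIn (fun z hz ↦ (connectedComponentIn_subset _ _ hz : z ∈ V))
    (fun S hS hSV ⟨z, hzS, hzW⟩ ↦ ?_) hC hCΩ hWC hy hK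
  have hSV' : S ⊆ V := fun z' hz' ↦ show ImageNull D.foliated z' from hSV z' hz'
  have h : S ⊆ connectedComponentIn V z := hS.subset_connectedComponentIn hzS hSV'
  rwa [← connectedComponentIn_eq hzW] at h

end PunctureData

end Literature.Topology.PlanarFoliations
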